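import Mathlib
import Summits.CriticalPhenomena.CardyFormulaZ2.Theorems.CardySelfRefinementDefs
import Summits.CriticalPhenomena.CardyFormulaZ2.Theorems.CardySelfRefinementRussoDriftPolynomial
import Summits.CriticalPhenomena.CardyFormulaZ2.Theorems.CardySelfRefinementTrivialSectorRateStubPivotalMassDictionary
import Summits.CriticalPhenomena.CardyFormulaZ2.Theorems.CardySelfRefinementTrivialSectorRateStubSixArmSectorMassLocality
import Summits.CriticalPhenomena.CardyFormulaZ2.Theorems.CardySelfRefinementTrivialSectorRateStubSixArmSectorMassFactorisation
import Summits.CriticalPhenomena.CardyFormulaZ2.Theorems.CardySelfRefinementGradientComparabilityStubBoundaryValuesHi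
import Summits.CriticalPhenomena.CardyFormulaZ2.Theorems.CardySelfRefinementGradientComparabilityStubBulkPivotalSumDivergesSmall
import Literature.Probability.Percolation.PivotalCell
import Literature.Probability.Percolation.FourArmGarbanShift
import Literature.Probability.Percolation.SelfRefinementMeasure
import Literature.Probability.Percolation.QuadCrossingFourArmShadow
import Literature.Probability.Percolation.QuadCrossingRawClosed
import Literature.Probability.Percolation.QuadCrossingSpaceZ2
import Literature.Probability.Percolation.QuadCrossingQuadTopology
import Literature.Probability.LatticeModels.DomainDiscretisation
import HarnessLib

/-!
# Stub `stub_farFieldFactorisation` of line `far-field-is-a-quarter-turn` (crux `TrivialSectorRate`,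
stmt-CriticalPhenomena-10266): FAR-FIELD FACTORISATION OF BLOCK RELEVANCE — hypothesis (HT) of the tree's
`weightedPivotalMass_of_factorisation` (…StubPivotalMassSummation): for a block whose `2R`-box stays below its far
field (`4ηR < bdist`), `M_k(Rel u k) ≤ C₁ · M_k(fourArmTwoClustersAt (k•u) r₁ R) · M_k(Rel u (2R))` with
`C₁ = 1`, `r₁ = 2k + 2`, `R ≥ R₁ = 2k + 3`.

* (A) MONOTONICITY `Rel u k ⊆ Rel u (2R)` (`Rel_mono`).
* (B) TOPOLOGY (`mem_fourArmTwoClustersAt_of_mem_Rel`): on lattice configurations, relevance of the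
  `k`-box `B` forces four alternating arms from the ring `2k+2` to `R` about the block centre.  The
  localised joint crossing event `Aloc` is an upper set, so `ω ∪ B ∈ Aloc ∌ ω \ B`
  (`union_mem_and_sdiff_notMem_of_isPivotalOn`); hence some quad `F i` is crossed (closure semantics =
  crossing inside the drawn open edges, the tree's `mem_configOf_iff_exists_isCrossing`) by the window part
  of `ω ∪ B` and not by that of `ω \ B`.  The drawing of `B` lies in the disc of radius `2kδ`
  (`δ = η√2`) about the drawn centre `c`, the sides of `F i` lie on `∂[F i] ⊆ quadBdry` at distance
  `≥ bdist > 2√2 R δ` from `c`, and the disc `B(c, bdist)` — meeting the crossing, missing `∂[F i]` — lies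
  inside `[F i]`; the tree's `Quad.relabel_mem_fourArmTwoClusters_of_isCrossing` (Schramm–Smirnov's "four
  arms from `∂B_j` to `∂Q₀`", `QuadCrossingFourArmShadow.lean`) then puts the window part of `ω \ B` in the
  four-arm event, which is a cylinder over the annulus pairs (`determinedBy_fourArmTwoClustersAt`), on
  which it agrees with `ω` (annulus edges are off `B` and drawn inside `[F i]`, hence in the window).
* (C) INDEPENDENCE (`real_fourArmTwoClustersAt_inter_Rel_eq_mul`): the four-arm event inside the `R`-box and
  the relevance of the `2R`-box read disjoint coin windows (`disjoint_coinsOf_of_far`,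
  `determinedBy_Rel_compl`), so they multiply under the coin product
  (`prodBernoulli_real_inter_of_determinedBy`; mirror of `real_sixArmThreeClustersAt_inter_Rel_eq_mul`).

Target file: `Summits/CriticalPhenomena/CardyFormulaZ2/Theorems/CardySelfRefinementTrivialSectorRateStubFarFieldFactorisation.lean`.
-/

noncomputable section

namespace Summit.CriticalPhenomena.CardyFormulaZ2.Theorems.CardySelfRefinement.FarField

open scoped Topology
open Filter Set MeasureTheory
open Literature.Probability.LatticeModels Literature.Probability.Percolation
open Literature.Probability.Percolation.QuadCrossing
open Summit.CriticalPhenomena.CardyFormulaZ2.Theses.CardySelfRefinement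

/-! ## Upper sets: the normal form of set-pivotality -/

/-- For an increasing event `A`, a set `C` is pivotal in `ω` iff opening all of `C` realises `A` and
closing all of `C` destroys it: the normal form `ω ∪ C ∈ A`, `ω \ C ∉ A`. -/
theorem union_mem_and_sdiff_notMem_of_isPivotalOn {ι : Type*} {A : Set (Set ι)} (hA : IsUpperSet A)
    {C ω : Set ι} (h : IsPivotalOn A C ω) : ω ∪ C ∈ A ∧ ω \ C ∉ A := by
  obtain ⟨ω', hagree, hflip⟩ := h
  have h1 : ω \ C ⊆ ω' := fun i hi => (hagree i hi.2).2 hi.1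
  have h2 : ω' ⊆ ω ∪ C := fun i hi => by
    by_cases hiC : i ∈ C
    · exact Or.inr hiC
    · exact Or.inl ((hagree i hiC).1 hi)
  by_contra hcon
  rw [not_and_or, not_not] at hcon
  rcases hcon with hU | hD
  · exact hflip ⟨fun h' => absurd (hA h2 h') hU, fun h' => absurd (hA subset_union_left h') hU⟩
  · exact hflip ⟨fun _ => hA (show ω \ C ⊆ ω from fun _ hi => hi.1) hD, fun _ => hA h1 hD⟩

/-! ## Drawn sites: the mesh `δ = η√2` (`eta_mul_z_eq_meshPoint`) -/

/-- Mesh points are additive: `δa − δv = δ(a − v)`. -/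
theorem meshPoint_sub (δ : ℝ) (a v : Site 2) : meshPoint δ a - meshPoint δ v = meshPoint δ (a - v) := by
  apply Complex.ext <;> simp [mul_sub]

/-- A site of the lattice `R`-box about `v` is drawn within `√2 R δ` of the drawn centre. -/
theorem dist_meshPoint_le_of_sub_mem_box {δ : ℝ} (hδ : 0 ≤ δ) {a v : Site 2} {R : ℕ}
    (h : a - v ∈ box 2 R) : dist (meshPoint δ a) (meshPoint δ v) ≤ Real.sqrt 2 * (R * δ) := by
  rw [dist_eq_norm, meshPoint_sub]
  exact (Complex.norm_le_sqrt_two_mul_max _).trans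
    (mul_le_mul_of_nonneg_left (max_le_of_mem_box hδ h) (Real.sqrt_nonneg 2))

/-- The drawing of the edges of the lattice `R`-box about `v` lies in the closed disc of radius `√2 R δ`
about the drawn centre. -/
theorem openEdgeUnion_boxEdgesAt_subset {δ : ℝ} (hδ : 0 ≤ δ) (v : Site 2) (R : ℕ) :
    openEdgeUnion δ (boxEdgesAt v R) ⊆ Metric.closedBall (meshPoint δ v) (Real.sqrt 2 * (R * δ)) := by
  intro z hz
  obtain ⟨x, y, -, hB, hz⟩ := mem_openEdgeUnion_iff.1 hz
  have hx : x - v ∈ box 2 R := hB.2 x (Sym2.mem_mk_left x y)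
  have hy : y - v ∈ box 2 R := hB.2 y (Sym2.mem_mk_right x y)
  exact (convex_closedBall _ _).segment_subset
    (Metric.mem_closedBall.2 (dist_meshPoint_le_of_sub_mem_box hδ hx))
    (Metric.mem_closedBall.2 (dist_meshPoint_le_of_sub_mem_box hδ hy)) hz

/-! ## The four-arm event is a cylinder over the annulus -/

/-- **`fourArmTwoClustersAt c r n` is determined by the pairs of sites of the annulus `c + A_{r,n}`**
(each `openConnIn` is, `PlanarDuality.determinedBy_openConnIn`). -/
theorem determinedBy_fourArmTwoClustersAt (c : Site 2) (r n : ℕ) :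
    DeterminedBy (fourArmTwoClustersAt c r n)
      (↑((annulus 2 (r - 1) n).image (· + c)).sym2 : Set (Sym2 (Site 2))) := by
  have hS := image_add_sqAnnulus_eq_coe c r n
  have hconn : ∀ x y : Site 2, DeterminedBy (openConnIn ((· + c) '' sqAnnulus r n) x y)
      (↑((annulus 2 (r - 1) n).image (· + c)).sym2 : Set (Sym2 (Site 2))) := by
    intro x y
    rw [hS]
    exact PlanarDuality.determinedBy_openConnIn _ x y
  rw [determinedBy_iff]
  intro ω ω' h
  have hc : ∀ x y : Site 2, ω ∈ openConnIn ((· + c) '' sqAnnulus r n) x y ↔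
      ω' ∈ openConnIn ((· + c) '' sqAnnulus r n) x y :=
    fun x y => (determinedBy_iff _ _).1 (hconn x y) ω ω' h
  simp only [fourArmTwoClustersAt, Set.mem_setOf_eq, hc]

/-- The four-arm event is measurable. -/
theorem measurableSet_fourArmTwoClustersAt (c : Site 2) (r n : ℕ) :
    MeasurableSet (fourArmTwoClustersAt c r n) :=
  (determinedBy_fourArmTwoClustersAt c r n).measurableSet_of_finset

/-! ## Topology: relevance of the `k`-box forces four arms about the block -/

/-- **Relevance of the block forces four alternating arms.**  Let `0 < k`, `0 < η`, `2k + 3 ≤ R`,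
`4ηR < bdist k m F η u`, and let the lattice configuration `ω` make the `k`-box about `k•u` relevant
(`ω ∈ Rel k m F η u k`).  Then `ω ∈ fourArmTwoClustersAt (k•u) (2k+2) R`: two open crossings of the
annulus `k•u + A_{2k+2,R}` not joined inside it. -/
theorem mem_fourArmTwoClustersAt_of_mem_Rel {k : ℕ} (hk : 0 < k) (m : ℕ) (F : Fin m → Quad (univ : Set ℂ))
    {η : ℝ} (hη : 0 < η) (u : Site 2) {R : ℕ} (hR : 2 * k + 3 ≤ R)
    (hfar : 4 * η * R < bdist k m F η u) {ω : BondConfig (Site 2)} (hω : ω ⊆ (zdGraph 2).edgeSet)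
    (hRel : ω ∈ Rel k m F η u k) : ω ∈ fourArmTwoClustersAt (ctr k u) (2 * k + 2) R := by
  classical
  -- the drawn sites and the distance to the quad boundaries, before abbreviating
  have hz : ∀ x : Site 2, (η : ℂ) * squareLatticeEmbedding.z x = meshPoint (η * Real.sqrt 2) x :=
    eta_mul_z_eq_meshPoint η
  have hfrB : ∀ p ∈ quadBdry m F, bdist k m F η u ≤ dist (meshPoint (η * Real.sqrt 2) (ctr k u)) p :=
    fun p hp => (Metric.infDist_le_dist_of_mem hp).trans_eq (by rw [hz])
  have hRel' : IsPivotalOn (Aloc m F η) (boxEdgesAt (ctr k u) k) ω := hRel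
  -- constants
  set s : ℝ := Real.sqrt 2 with hsdef
  have hs0 : 0 ≤ s := Real.sqrt_nonneg 2
  have hss : s * s = 2 := Real.mul_self_sqrt (by norm_num)
  have hs1 : 1 < s := by nlinarith
  have hs2 : s < 2 := by nlinarith
  have hs0' : 0 < s := by linarith
  set δ : ℝ := η * s with hδdef
  have hδ : 0 < δ := mul_pos hη hs0'
  have hk1 : (1 : ℝ) ≤ k := by exact_mod_cast hk
  have hk0r : (0 : ℝ) < k := by linarith
  have hRr : (2 : ℝ) * k + 3 ≤ R := by exact_mod_cast hR
  have hR5 : (5 : ℝ) ≤ R := by linarith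
  set v : Site 2 := ctr k u with hvdef
  set c : ℂ := meshPoint δ v with hcdef
  set d : ℝ := bdist k m F η u with hddef
  -- `4ηR = 2√2 R δ`
  have h4 : 4 * η * (R : ℝ) = 2 * s * R * δ := by
    rw [hδdef]; linear_combination (-2 * η * R) * hss
  have hd2 : 2 * s * R * δ < d := by rw [h4] at hfar; exact hfar
  have hsδ : 0 < s * δ := mul_pos hs0' hδ
  have h5sδ : s * δ * 5 ≤ s * δ * R := mul_le_mul_of_nonneg_left hR5 hsδ.le
  have hδsδ : 1 * δ < s * δ := mul_lt_mul_of_pos_right hs1 hδ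
  -- radii
  set ρ : ℝ := 2 * k * δ with hρdef
  set Rf : ℝ := s * ((R + 1) * δ) + δ with hRfdef
  have hRf_lt_d : Rf < d := by nlinarith
  have hR3_lt_d : s * ((R + 1 + 2) * δ) < d := by nlinarith
  have hR_lt_d : s * (R * δ) < d := by nlinarith
  have hsk_lt_ρ : s * (k * δ) < ρ := by
    have := mul_pos (mul_pos (sub_pos.2 hs2) hk0r) hδ
    nlinarith
  have hρR : ρ ≤ Rf := by
    have h1 : (2 : ℝ) * k ≤ R + 1 := by linarith
    have h2 : 2 * k * δ ≤ (R + 1) * δ := mul_le_mul_of_nonneg_right h1 hδ.le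
    have h3 : 1 * ((R + 1) * δ) ≤ s * ((R + 1) * δ) :=
      mul_le_mul_of_nonneg_right hs1.le (by positivity)
    nlinarith
  have hρd : ρ ≤ d := hρR.trans hRf_lt_d.le
  -- Step 1: normal form of relevance for the upper set `Aloc`
  obtain ⟨hU, hD⟩ := union_mem_and_sdiff_notMem_of_isPivotalOn (isUpperSet_Aloc m F η) hRel'
  simp only [Aloc, Set.mem_setOf_eq] at hU hD
  push Not at hD
  obtain ⟨i, hi⟩ := hD
  have hiU := hU i
  -- Step 2: crossings inside the drawn open edges
  have hτe : (ω ∪ boxEdgesAt v k) ∩ window m F η ⊆ (zdGraph 2).edgeSet :=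
    fun e he => he.1.elim (fun h => hω h) (fun h => h.1)
  have hσe : (ω \ boxEdgesAt v k) ∩ window m F η ⊆ (zdGraph 2).edgeSet :=
    fun e he => hω he.1.1
  obtain ⟨K, hK, hKτ⟩ := (mem_configOf_iff_exists_isCrossing hη hτe (F i)).1 hiU
  have hno : ∀ K', (F i).IsCrossing K' →
      ¬ K' ⊆ openEdgeUnion δ ((ω \ boxEdgesAt v k) ∩ window m F η) :=
    fun K' hK' hsub => hi ((mem_configOf_iff_exists_isCrossing hη hσe (F i)).2 ⟨K', hK', hsub⟩)
  -- Step 3: off the disc `B(c, ρ)` the crossing lies in the drawing of `(ω \ B) ∩ W`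
  have hBball : openEdgeUnion δ (boxEdgesAt v k) ⊆ Metric.ball c ρ :=
    (openEdgeUnion_boxEdgesAt_subset hδ.le v k).trans (Metric.closedBall_subset_ball hsk_lt_ρ)
  have hKO : K \ Metric.ball c ρ ⊆ openEdgeUnion δ ((ω \ boxEdgesAt v k) ∩ window m F η) := by
    rintro z ⟨hzK, hzball⟩
    obtain ⟨x, y, hxy, ⟨hωB, hW⟩, hzseg⟩ := mem_openEdgeUnion_iff.1 (hKτ hzK)
    by_cases hB : s(x, y) ∈ boxEdgesAt v k
    · exact absurd (hBball (mem_openEdgeUnion_iff.2 ⟨x, y, hxy, hB, hzseg⟩)) hzball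
    · exact mem_openEdgeUnion_iff.2 ⟨x, y, hxy, ⟨⟨hωB.resolve_right hB, hB⟩, hW⟩, hzseg⟩
  -- the crossing meets the disc
  obtain ⟨y₀, hy₀K, hy₀b⟩ : ∃ y ∈ K, y ∈ Metric.ball c ρ := by
    by_contra h
    push Not at h
    exact hno K hK fun z hz => hKO ⟨hz, h z hz⟩
  -- Step 4: the disc `B(c, bdist)` misses `∂[F i]`, meets `[F i]`, hence lies inside it
  have hfrQ : ∀ p ∈ frontier (F i).carrier, d ≤ dist c p :=
    fun p hp => hfrB p (Set.mem_iUnion.2 ⟨i, hp⟩)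
  have hQcl : IsClosed (F i).carrier := (F i).isCompact_carrier.isClosed
  have hcov : Metric.ball c d ⊆ interior (F i).carrier ∪ (F i).carrierᶜ := fun w hw => by
    by_cases hwQ : w ∈ (F i).carrier
    · left
      by_contra hwi
      have := hfrQ w ⟨subset_closure hwQ, hwi⟩
      rw [Metric.mem_ball'] at hw
      linarith
    · exact Or.inr hwQ
  have hball : Metric.ball c d ⊆ interior (F i).carrier := by
    have hy₀d : y₀ ∈ Metric.ball c d := Metric.ball_subset_ball hρd hy₀b
    have hy₀i : y₀ ∈ interior (F i).carrier :=
      (hcov hy₀d).resolve_right fun h => h (hK.2.2.1 hy₀K)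
    exact (convex_ball c d).isPreconnected.subset_left_of_subset_union isOpen_interior
      hQcl.isOpen_compl (Set.disjoint_left.2 fun w hw hwc => hwc (interior_subset hw)) hcov
      ⟨y₀, hy₀d, hy₀i⟩
  -- Step 5: the sides `∂₀, ∂₂` are far from the centre
  have hfar' : ∀ z ∈ (F i).side 0 ∪ (F i).side 2, Rf < dist z c := fun z hz => by
    have hzf : z ∈ frontier (F i).carrier := by
      rcases hz with h | h
      exacts [(F i).side_subset_frontier 0 h, (F i).side_subset_frontier 2 h]
    have := hfrQ z hzf
    rw [dist_comm] at this
    linarith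
  -- Step 6: the tree's two-arms lemma about the centre `c = δ v`
  have hns : nearestSite δ c = v := by rw [hcdef]; exact nearestSite_meshPoint hδ.ne' v
  have hT : {z : ℂ | max |(z - meshPoint δ (nearestSite δ c)).re| |(z - meshPoint δ (nearestSite δ c)).im| ≤
      (((R + 1 : ℕ) : ℝ) + 2) * δ} ⊆ (F i).carrier := by
    intro z hz'
    rw [Set.mem_setOf_eq, hns, ← hcdef] at hz'
    push_cast at hz'
    have h2 : ‖z - c‖ < d :=
      calc ‖z - c‖ ≤ s * max |(z - c).re| |(z - c).im| := Complex.norm_le_sqrt_two_mul_max _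
        _ ≤ s * ((R + 1 + 2) * δ) := mul_le_mul_of_nonneg_left hz' hs0
        _ < d := hR3_lt_d
    have : z ∈ Metric.ball c d := by rw [Metric.mem_ball, dist_eq_norm]; exact h2
    exact interior_subset (hball this)
  have hρm : ρ + δ ≤ ((2 * k + 1 : ℕ) : ℝ) * δ := le_of_eq (by rw [hρdef]; push_cast; ring)
  have hnR : Real.sqrt 2 * (((R + 1 : ℕ) : ℝ) * δ) ≤ Rf - δ := le_of_eq (by rw [hRfdef]; push_cast; ring)
  have hfour := (F i).relabel_mem_fourArmTwoClusters_of_isCrossing hδ hσe hK hKO hno hρR hfar'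
    (m' := 2 * k + 1) (n' := R + 1) (by omega) (by omega) hρm hnR hT
  have e1 : 2 * k + 1 + 1 = 2 * k + 2 := by ring
  rw [hns, Nat.add_sub_cancel, e1] at hfour
  have hσ4 : (ω \ boxEdgesAt v k) ∩ window m F η ∈ fourArmTwoClustersAt v (2 * k + 2) R := by
    rw [fourArmTwoClustersAt_eq_preimage, Set.mem_preimage]
    exact hfour
  -- Step 7: the four-arm event reads only annulus pairs, on which `(ω \ B) ∩ W` agrees with `ω`
  refine ((determinedBy_iff _ _).1 (determinedBy_fourArmTwoClustersAt v (2 * k + 2) R) _ ω ?_).1 hσ4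
  ext e
  refine Sym2.inductionOn e fun x y => ?_
  constructor
  · rintro ⟨⟨⟨hxω, -⟩, -⟩, hE⟩
    exact ⟨hxω, hE⟩
  · rintro ⟨hxω, hE⟩
    have hxS : x ∈ (annulus 2 (2 * k + 2 - 1) R).image (· + v) :=
      Finset.mem_sym2_iff.1 (Finset.mem_coe.1 hE) x (Sym2.mem_mk_left x y)
    obtain ⟨a, ha, hax⟩ := Finset.mem_image.1 hxS
    rw [mem_annulus] at ha
    have hxv : x - v = a := by rw [← hax]; exact add_sub_cancel_right a v
    refine ⟨⟨⟨hxω, fun hxB => ha.2 ?_⟩, ?_⟩, hE⟩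
    · have hxk : x - v ∈ box 2 k := hxB.2 x (Sym2.mem_mk_left x y)
      rw [hxv] at hxk
      exact box_mono 2 (by omega) hxk
    · -- the edge is drawn inside `[F i]`, hence lies in the window
      have hxR : x - v ∈ box 2 R := by rw [hxv]; exact ha.1
      have hxball : meshPoint δ x ∈ Metric.ball c d := by
        rw [Metric.mem_ball]
        exact (dist_meshPoint_le_of_sub_mem_box hδ.le hxR).trans_lt hR_lt_d
      have hxth : meshPoint δ x ∈ Metric.thickening 1 (F i).carrier :=
        Metric.self_subset_thickening one_pos _ (interior_subset (hball hxball))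
      rw [window, Set.mem_iUnion]
      refine ⟨i, ⟨x, y, rfl, meshPoint δ x, ?_, hxth⟩, hω hxω⟩
      rw [hz x, hz y]
      exact left_mem_segment ℝ _ _

/-! ## Independence: the four-arm event inside the `R'`-box and the relevance of the `R`-box -/

/-- **Independence of the four-arm event inside the `R'`-box and the relevance of the `R`-box**
(`R' + k ≤ R`, `η ≠ 0`): under `M_k(q)` the two events multiply (they read disjoint coin windows). -/
theorem real_fourArmTwoClustersAt_inter_Rel_eq_mul {k : ℕ} (hk : 0 < k) (m : ℕ)
    (F : Fin m → Quad (univ : Set ℂ)) {η : ℝ} (hη : η ≠ 0) (q : ℝ × ℝ) (u : Site 2) (r : ℕ)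
    {R' R : ℕ} (hR : R' + k ≤ R) :
    (M k q.1 q.2).real (fourArmTwoClustersAt (ctr k u) r R' ∩ Rel k m F η u R) =
      (M k q.1 q.2).real (fourArmTwoClustersAt (ctr k u) r R') *
        (M k q.1 q.2).real (Rel k m F η u R) := by
  classical
  set X := fourArmTwoClustersAt (ctr k u) r R' with hX
  set Y := Rel k m F η u R with hY
  have hXm : MeasurableSet X := measurableSet_fourArmTwoClustersAt _ _ _
  have hYm : MeasurableSet Y := measurableSet_Rel k m F hη u R
  rw [map_measureReal_apply (measurable_cfg k) (hXm.inter hYm),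
    map_measureReal_apply (measurable_cfg k) hXm, map_measureReal_apply (measurable_cfg k) hYm,
    Set.preimage_inter]
  set W : Set (Sym2 (Site 2)) := ↑((annulus 2 (r - 1) R').image (· + ctr k u)).sym2 with hW
  have hWfin : W.Finite := Finset.finite_toSet _
  have hCWfin : (coinWindow k W).Finite := coinWindow_finite k hWfin
  set Kc : Finset Coin := hCWfin.toFinset with hKc
  have hKcc : (↑Kc : Set Coin) = coinWindow k W := Set.Finite.coe_toFinset _
  have hXd : DeterminedBy ((cfg k) ⁻¹' X) (↑Kc : Set Coin) := by
    rw [hKcc]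
    exact determinedBy_preimage_cfg k (determinedBy_fourArmTwoClustersAt (ctr k u) r R')
  have hYd : DeterminedBy ((cfg k) ⁻¹' Y) (↑Kc : Set Coin)ᶜ := by
    refine (determinedBy_preimage_cfg k (determinedBy_Rel_compl k m F η u R)).mono ?_
    rw [hKcc]
    intro i hi hiK
    obtain ⟨vd', hvd', hi'⟩ := Set.mem_iUnion₂.1 hi
    obtain ⟨vd, hvd, hiv⟩ := Set.mem_iUnion₂.1 hiK
    have hin : ∀ w ∈ edgeOf vd, w - ctr k u ∈ box 2 R' := sub_mem_box_of_mem_sym2_annulus hvd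
    exact Set.disjoint_left.1 (disjoint_coinsOf_of_far hk hR hin hvd') hiv hi'
  exact prodBernoulli_real_inter_of_determinedBy _ Kc hXd hYd ((measurable_cfg k) hXm)
    ((measurable_cfg k) hYm)

/-! ## The stub -/

/-- **Far-field factorisation of block relevance** (registered stub `stub_farFieldFactorisation` of
crux stmt-CriticalPhenomena-10266, line `far-field-is-a-quarter-turn`). -/
theorem stub_farFieldFactorisation :
    ∀ k : ℕ, k = 2 ∨ k = 3 → ∀ γ : unitInterval → ℝ × ℝ, ∀ (m : ℕ) (F : Fin m → Quad (univ : Set ℂ)),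
      ∃ (C₁ : ℝ) (r₁ R₁ : ℕ), 1 ≤ r₁ ∧ ∀ (s : unitInterval) (η : ℝ), 0 < η → ∀ (u : Site 2) (R : ℕ),
        R₁ ≤ R → 4 * η * R < bdist k m F η u →
          (M k (γ s).1 (γ s).2).real (Rel k m F η u k) ≤
            C₁ * (M k (γ s).1 (γ s).2).real (fourArmTwoClustersAt (ctr k u) r₁ R) *
              (M k (γ s).1 (γ s).2).real (Rel k m F η u (2 * R)) := by
  intro k hk γ m F
  have hk0 : 0 < k := by rcases hk with rfl | rfl <;> norm_num
  refine ⟨1, 2 * k + 2, 2 * k + 3, by omega, ?_⟩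
  intro s η hη u R hR hfar
  have hae : ∀ᵐ ω ∂(M k (γ s).1 (γ s).2), ω ⊆ (zdGraph 2).edgeSet :=
    selfRefinementMeasure_ae_subset_edgeSet k (γ s).1 (γ s).2
  have hsub : ∀ᵐ ω ∂(M k (γ s).1 (γ s).2), ω ∈ Rel k m F η u k →
      ω ∈ fourArmTwoClustersAt (ctr k u) (2 * k + 2) R ∩ Rel k m F η u (2 * R) := by
    filter_upwards [hae] with ω hω h
    exact ⟨mem_fourArmTwoClustersAt_of_mem_Rel hk0 m F hη u hR hfar hω h,
      Rel_mono k m F η u (by omega) h⟩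
  have h1 : (M k (γ s).1 (γ s).2).real (Rel k m F η u k) ≤
      (M k (γ s).1 (γ s).2).real (fourArmTwoClustersAt (ctr k u) (2 * k + 2) R ∩ Rel k m F η u (2 * R)) :=
    ENNReal.toReal_mono (measure_ne_top _ _) (measure_mono_ae hsub)
  rw [one_mul, ← real_fourArmTwoClustersAt_inter_Rel_eq_mul hk0 m F hη.ne' (γ s) u (2 * k + 2)
    (by omega : R + k ≤ 2 * R)]
  exact h1

end Summit.CriticalPhenomena.CardyFormulaZ2.Theorems.CardySelfRefinement.FarField

end
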